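import Summits.ResolutionOfSingularities.ResolutionOfSingularities.Theorems.UniversalCellsCampaignW82FamilyResolutionInsepLinks
import Summits.ResolutionOfSingularities.ResolutionOfSingularities.Theorems.UniversalCellsPrimeFieldToPerfectOfFamilyResolutionInsepOneFibre
import HarnessLib

/-!
# [OURS · L1 W8.2 door 1] THE CRUX `PrimeFieldToPerfect` IS «ONE SMOOTH CLOSED FIBRE OVER A FINITE FIELD,
# FLATLY, AFTER A RADICIAL BASE EXTENSION» — by-name links (Theses-importing leaf)

Route `ResolutionOfSingularities/UniversalCells`, crux `PrimeFieldToPerfect`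
(stmt-ResolutionOfSingularities-15233: resolution over `Spec (ZMod p)` ⇒ resolution over every PERFECT field
of characteristic `p`). Gen 5 proved `PerfectRes p ↔ FamilyResolutionInsep p (ZMod p)` and
`Theses.UniversalCells.PrimeFieldToPerfect ↔ ∀ p, PrimeFieldRes-integral p → FamilyResolutionInsep p (ZMod p)`
(p535806). Gen 6 typed the strong and the one-closed-fibre radicial family forms
(`SmoothFamilyResolutionInsep`, `FamilyResolutionInsepOneFibre`, p548038) and proved: resolution over all
perfect fields ⇒ strong form ⇒ (gen-5 form and) one-fibre form ⇒ resolution over every perfect `K ⊇ k`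
(`PrimeModelTransfer.hasResolution_of_familyResolutionInsepOneFibre`, EGA IV₃ 12.2.4 (iii)). THIS FILE
records the equivalences BY NAME:

* `integralPerfectRes_iff_smoothFamilyResolutionInsep`, `integralPerfectRes_iff_familyResolutionInsepOneFibre`
  — at `k = ZMod p`;
* `familyInsepForms_tfae` — **`[IntegralPerfectRes p, FamilyResolutionInsep p (ZMod p),
  SmoothFamilyResolutionInsep p (ZMod p), FamilyResolutionInsepOneFibre p (ZMod p)].TFAE`** (with
  `IntegralPerfectRes p` spelled out: resolution of integral separated finite-type schemes over all perfect
  fields of characteristic `p`);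
* `perfectRes_iff_familyResolutionInsepOneFibre` — **`Theorems.PerfectRes p ↔ FamilyResolutionInsepOneFibre p
  (ZMod p)`**: resolution over ALL PERFECT fields of characteristic `p` ⟺ for every proper family over a
  finitely generated `𝔽_p`-domain with integral radicial generic fibre, after a RADICIAL finite-type base
  extension, SOME proper modification of the family, flat along ONE closed fibre — a variety over a FINITE
  FIELD — and an isomorphism over an open meeting it, has that fibre smooth;
* `primeFieldTransferAt_iff_familyResolutionInsepOneFibre`, `primeFieldToPerfect_iff_familyResolutionInsepOneFibre`
  (route declaration) and the closer shape `primeFieldToPerfect_of_forall_familyResolutionInsepOneFibre`;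
* for every `k` of characteristic `p`: the one-way `familyResolutionInsepOneFibre_of_perfectRes`.

Reading for the slot (W8.2 «resolve over 𝔽_p and transfer FAMILIES»; KERNEL-c3 §1): door 1's residual is a
statement about 𝔽_p-SCHEMES and FINITE-FIELD FIBRES only — «resolve ONE general closed fibre of the
(radicially base-extended) 𝔽_p-family by a modification of the whole family that is FLAT there». Grade:
open-problem (⟺ crux slice); rungs as for `FamilyResolutionInsep` (curves unconditional, `≤ 3` ⇐ F-02,
p537746).

[OURS · LADDER-RESOLUTION L1, slot W8.2 (prime-field / universality transfer), door 1 UniversalCells]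
Theorems over the summit's own route and OURS names; NOT statements of, and attributing nothing to,
Hironaka's 2017 manuscript (the OURS `Prop`s replace the role of §17 ¶2, p.89 l.59–62). AI-written; weaker
than expert review. Theses-importing LEAF (imports the gen-5 door-1 links leaf for
`integralPerfectRes_iff_familyResolutionInsep` / `hasResolution_of_isReduced_of_forall_isIntegral` /
`primeFieldToPerfect_iff`, and otherwise Theses-free modules); nothing imports this file.
-/

noncomputable section

set_option linter.dupNamespace false -- mandated namespace of this single-conjunct summit

open CategoryTheory CategoryTheory.Limits AlgebraicGeometry TopologicalSpace
open Literature.AlgebraicGeometry.Resolution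

namespace Summit.ResolutionOfSingularities.ResolutionOfSingularities.Theorems.CampaignW82

/-! ## For every field of characteristic `p`: the one-way implication -/

/-- **`PerfectRes p → FamilyResolutionInsepOneFibre p k`** for every field `k` of characteristic `p`
(resolution over perfect fields ⇒ strong radicial form ⇒ one-closed-fibre form). [folklore] -/
theorem familyResolutionInsepOneFibre_of_perfectRes (p : ℕ) [Fact p.Prime]
    (h : Summit.ResolutionOfSingularities.ResolutionOfSingularities.Theorems.PerfectRes p)
    (k : Type) [Field k] [CharP k p] : FamilyResolutionInsepOneFibre p k :=
  PrimeModelTransfer.familyResolutionInsepOneFibre_of_smoothFamilyResolutionInsep p k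
    (PrimeModelTransfer.smoothFamilyResolutionInsep_of_integralPerfectRes p
      (fun K _ _ _ X f hs hl hq hX => by haveI := hX; exact h K X f hs hl hq inferInstance) k)

/-! ## At the prime field: equivalences -/

/-- **Resolution of integral schemes over all perfect fields of characteristic `p` ⟺
`SmoothFamilyResolutionInsep p (ZMod p)`.** [folklore] -/
theorem integralPerfectRes_iff_smoothFamilyResolutionInsep (p : ℕ) [Fact p.Prime] :
    (∀ (K : Type) [Field K] [CharP K p] [PerfectField K] (X : Scheme.{0}) (f : X ⟶ Spec (.of K)),
        IsSeparated f → LocallyOfFiniteType f → QuasiCompact f → IsIntegral X → Scheme.HasResolution X) ↔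
      SmoothFamilyResolutionInsep p (ZMod p) :=
  ⟨fun h => PrimeModelTransfer.smoothFamilyResolutionInsep_of_integralPerfectRes p h (ZMod p),
    fun h => PrimeModelTransfer.integralPerfectRes_of_familyResolutionInsepOneFibre p
      (PrimeModelTransfer.familyResolutionInsepOneFibre_of_smoothFamilyResolutionInsep p (ZMod p) h)⟩

/-- **Resolution of integral schemes over all perfect fields of characteristic `p` ⟺
`FamilyResolutionInsepOneFibre p (ZMod p)`** (← the E7 direction
`PrimeModelTransfer.hasResolution_of_familyResolutionInsepOneFibre`). [folklore] -/
theorem integralPerfectRes_iff_familyResolutionInsepOneFibre (p : ℕ) [Fact p.Prime] :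
    (∀ (K : Type) [Field K] [CharP K p] [PerfectField K] (X : Scheme.{0}) (f : X ⟶ Spec (.of K)),
        IsSeparated f → LocallyOfFiniteType f → QuasiCompact f → IsIntegral X → Scheme.HasResolution X) ↔
      FamilyResolutionInsepOneFibre p (ZMod p) :=
  ⟨fun h => PrimeModelTransfer.familyResolutionInsepOneFibre_of_smoothFamilyResolutionInsep p (ZMod p)
      (PrimeModelTransfer.smoothFamilyResolutionInsep_of_integralPerfectRes p h (ZMod p)),
    fun h => PrimeModelTransfer.integralPerfectRes_of_familyResolutionInsepOneFibre p h⟩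

/-- **THE FOUR DOOR-1 FORMS ARE EQUIVALENT** at the prime field: resolution of integral varieties over all
perfect fields of characteristic `p`; gen 5's radicial family form; the strong radicial form; the
one-closed-fibre radicial form. [folklore] -/
theorem familyInsepForms_tfae (p : ℕ) [Fact p.Prime] :
    [(∀ (K : Type) [Field K] [CharP K p] [PerfectField K] (X : Scheme.{0}) (f : X ⟶ Spec (.of K)),
        IsSeparated f → LocallyOfFiniteType f → QuasiCompact f → IsIntegral X → Scheme.HasResolution X),
      FamilyResolutionInsep p (ZMod p), SmoothFamilyResolutionInsep p (ZMod p),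
      FamilyResolutionInsepOneFibre p (ZMod p)].TFAE := by
  tfae_have 1 ↔ 2 := integralPerfectRes_iff_familyResolutionInsep p
  tfae_have 1 ↔ 3 := integralPerfectRes_iff_smoothFamilyResolutionInsep p
  tfae_have 1 ↔ 4 := integralPerfectRes_iff_familyResolutionInsepOneFibre p
  tfae_finish

/-- **`PerfectRes p ↔ FamilyResolutionInsepOneFibre p (ZMod p)`** — with the REDUCED wording of
`Theorems.PerfectRes` (reduced ⇐ integral over a fixed field: gen 5's
`hasResolution_of_isReduced_of_forall_isIntegral`). [folklore] -/
theorem perfectRes_iff_familyResolutionInsepOneFibre (p : ℕ) [Fact p.Prime] :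
    Summit.ResolutionOfSingularities.ResolutionOfSingularities.Theorems.PerfectRes p ↔
      FamilyResolutionInsepOneFibre p (ZMod p) := by
  rw [perfectRes_iff_familyResolutionInsep, ← integralPerfectRes_iff_familyResolutionInsep,
    integralPerfectRes_iff_familyResolutionInsepOneFibre]

/-- **THE CRUX SLICE IS THE ONE-CLOSED-FIBRE RADICIAL FORM OVER THE PRIME FIELD, BY NAME.**
`PrimeFieldTransferAt p ↔ (resolution of integral schemes over Spec (ZMod p) →
FamilyResolutionInsepOneFibre p (ZMod p))`. [folklore] -/
theorem primeFieldTransferAt_iff_familyResolutionInsepOneFibre (p : ℕ) [Fact p.Prime] :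
    PrimeFieldTransferAt p ↔
      ((∀ (X : Scheme.{0}) (f : X ⟶ Spec (.of (ZMod p))),
          IsSeparated f → LocallyOfFiniteType f → QuasiCompact f → IsIntegral X → Scheme.HasResolution X) →
        FamilyResolutionInsepOneFibre p (ZMod p)) :=
  imp_congr_right fun _ => perfectRes_iff_familyResolutionInsepOneFibre p

/-- **For the route declaration.** `Theses.UniversalCells.PrimeFieldToPerfect ↔ ∀ p [Fact p.Prime]`,
resolution over `Spec (ZMod p)` (integral schemes) implies `FamilyResolutionInsepOneFibre p (ZMod p)`.
[folklore] -/
theorem primeFieldToPerfect_iff_familyResolutionInsepOneFibre :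
    Summit.ResolutionOfSingularities.ResolutionOfSingularities.Theses.UniversalCells.PrimeFieldToPerfect ↔
      ∀ (p : ℕ) [Fact p.Prime],
        (∀ (X : Scheme.{0}) (f : X ⟶ Spec (.of (ZMod p))),
            IsSeparated f → LocallyOfFiniteType f → QuasiCompact f → IsIntegral X →
              Scheme.HasResolution X) →
          FamilyResolutionInsepOneFibre p (ZMod p) := by
  rw [primeFieldToPerfect_iff]
  constructor
  · intro h p hp
    exact (primeFieldTransferAt_iff_familyResolutionInsepOneFibre p).mp (h p hp.out)
  · intro h p hp
    haveI : Fact p.Prime := ⟨hp⟩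
    exact (primeFieldTransferAt_iff_familyResolutionInsepOneFibre p).mpr (h p)

/-- **Closer shape.** If, for every prime `p`, resolution over `Spec (ZMod p)` yields the one-closed-fibre
radicial family form over `ZMod p`, then `Theses.UniversalCells.PrimeFieldToPerfect` holds. [folklore] -/
theorem primeFieldToPerfect_of_forall_familyResolutionInsepOneFibre
    (h : ∀ (p : ℕ) [Fact p.Prime],
      (∀ (X : Scheme.{0}) (f : X ⟶ Spec (.of (ZMod p))),
          IsSeparated f → LocallyOfFiniteType f → QuasiCompact f → IsIntegral X → Scheme.HasResolution X) →
        FamilyResolutionInsepOneFibre p (ZMod p)) :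
    Summit.ResolutionOfSingularities.ResolutionOfSingularities.Theses.UniversalCells.PrimeFieldToPerfect :=
  primeFieldToPerfect_iff_familyResolutionInsepOneFibre.mpr h

end Summit.ResolutionOfSingularities.ResolutionOfSingularities.Theorems.CampaignW82

end
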